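import Mathlib
import HarnessLib
import Literature.MathematicalPhysics.QuantumFieldTheory.ConstructiveQFTWave0OddRPProofs
import Literature.MathematicalPhysics.QuantumFieldTheory.WilsonAxisSymmetry
import Literature.MathematicalPhysics.QuantumFieldTheory.LatticeGaugeProofs

/-!
# Wall reflections of the odd torus in an arbitrary axis (crux `ContinuumLegGivenGap`, stmt-QuantumFields-15828,
# line `alternating-curvature-arrays`, helper of `stub_arrayFunctional`)

The reflection `t ↦ A - t` of ONE coordinate `μ` of the discrete torus `(ℤ/S)^d` (`A : ℤ/S`; for odd `S` it fixes
one site hyperplane and the antipodal link hyperplane) and the induced map `configReflect μ A` on lattice gauge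
configurations (links along `μ` are reversed, hence inverted — the rule of `GaugeConfig.timeReflect`, which is the case
`μ = 0`, `A = 1`).  Everything is reduced to the tree's time reflection by CONJUGATION: `configReflect μ (1 - 2s)` is
`GaugeConfig.timeReflect` conjugated by the axis transposition `configPerm (swap 0 μ)` and the torus translation by
`s e₀` (`configReflect_eq_conj`); consequently it is an involution preserving Wilson's torus measure
(`measurePreserving_configReflect`), and the plaquette traces transform by reflecting the base corner, with the extra
shift `-e_μ` for plaquettes containing the axis `μ` (`re_tr_plaquetteHolonomy_configReflect`; `Re tr ρ(h g⁻¹ h⁻¹) =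
Re tr ρ(g)` for a continuous representation of a compact group).

References: K. Osterwalder, E. Seiler, Ann. Phys. 110 (1978) 440, §2; J. Fröhlich, R. Israel, E. H. Lieb, B. Simon,
Comm. Math. Phys. 62 (1978) 1, §2 (reflections in lattice hyperplanes).  All statements are elementary and proved.
-/

set_option autoImplicit false

noncomputable section

namespace Summit.QuantumFields.YangMills.Theorems.ContinuumLegGivenGap

open MeasureTheory
open Literature.MathematicalPhysics.QuantumFieldTheory Literature.MathematicalPhysics.QuantumLattice

/-! ## Site reflections -/

section Sites

variable {d S : ℕ}

/-- Reflection of the coordinate `μ` of a torus site through `A/2`: `x ↦ x[μ ↦ A - x_μ]`. [folklore] -/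
def siteReflect (μ : Fin d) (A : ZMod S) (x : Site d S) : Site d S :=
  Function.update x μ (A - x μ)

/-- The reflected coordinate. [folklore] -/
@[simp] theorem siteReflect_apply_same (μ : Fin d) (A : ZMod S) (x : Site d S) :
    siteReflect μ A x μ = A - x μ := by
  simp [siteReflect]

/-- The other coordinates are unchanged. [folklore] -/
theorem siteReflect_apply_of_ne (μ : Fin d) (A : ZMod S) (x : Site d S) {j : Fin d} (h : j ≠ μ) :
    siteReflect μ A x j = x j := by
  simp [siteReflect, h]

/-- `siteReflect` is an involution. [folklore] -/
@[simp] theorem siteReflect_siteReflect (μ : Fin d) (A : ZMod S) (x : Site d S) :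
    siteReflect μ A (siteReflect μ A x) = x := by
  funext j
  by_cases h : j = μ
  · subst h; simp
  · simp [siteReflect_apply_of_ne _ _ _ h]

/-- Reflecting the shifted site along the reflected axis: `θ(x + e_μ) = θx - e_μ`. [folklore] -/
theorem siteReflect_shift_same (μ : Fin d) (A : ZMod S) (x : Site d S) :
    siteReflect μ A (x.shift μ) = siteReflect μ A x - Pi.single μ 1 := by
  funext j
  by_cases h : j = μ
  · subst h; simp [Site.shift]; ring
  · simp [siteReflect_apply_of_ne _ _ _ h, Site.shift, h]

/-- Reflecting a site shifted along another axis: `θ(x + e_j) = θx + e_j`. [folklore] -/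
theorem siteReflect_shift_of_ne (μ : Fin d) (A : ZMod S) (x : Site d S) {j : Fin d} (h : j ≠ μ) :
    siteReflect μ A (x.shift j) = (siteReflect μ A x).shift j := by
  funext k
  by_cases hk : k = μ
  · subst hk; simp [Site.shift, h]
  · simp [siteReflect_apply_of_ne _ _ _ hk, Site.shift]

/-- Reflecting the site below: `θ(x - e_μ) = θx + e_μ`. [folklore] -/
theorem siteReflect_sub_single (μ : Fin d) (A : ZMod S) (x : Site d S) :
    siteReflect μ A (x - Pi.single μ 1) = siteReflect μ A x + Pi.single μ 1 := by
  funext j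
  by_cases h : j = μ
  · subst h; simp; ring
  · simp [siteReflect_apply_of_ne _ _ _ h, h]

/-- `θx = (θx - e_μ) + e_μ`. [folklore] -/
theorem siteReflect_eq_shift (μ : Fin d) (A : ZMod S) (x : Site d S) :
    siteReflect μ A x = (siteReflect μ A x - Pi.single μ 1).shift μ := by
  simp [Site.shift]

end Sites

/-! ## The configuration reflection -/

section Config

variable {d S : ℕ} {G : Type*} [Group G]

/-- **Reflection of lattice gauge configurations in the axis `μ` through `A/2`**: links along `μ` are reversed
(`x → x + e_μ` goes to `θx - e_μ → θx`... read backwards, whence the inverse), the other links are carried along.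
For `μ = 0`, `A = 1` this is `GaugeConfig.timeReflect`. [folklore] -/
def configReflect (μ : Fin d) (A : ZMod S) (U : GaugeConfig d S G) : GaugeConfig d S G :=
  fun e => if e.2 = μ then (U (siteReflect μ A (e.1.shift μ), μ))⁻¹ else U (siteReflect μ A e.1, e.2)

/-- Value on a link along the reflected axis. [folklore] -/
theorem configReflect_apply_same (μ : Fin d) (A : ZMod S) (U : GaugeConfig d S G) (x : Site d S) :
    configReflect μ A U (x, μ) = (U (siteReflect μ A x - Pi.single μ 1, μ))⁻¹ := by
  simp [configReflect, siteReflect_shift_same]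

/-- Value on a link across the reflected axis. [folklore] -/
theorem configReflect_apply_of_ne (μ : Fin d) (A : ZMod S) (U : GaugeConfig d S G) (x : Site d S) {j : Fin d}
    (h : j ≠ μ) : configReflect μ A U (x, j) = U (siteReflect μ A x, j) := by
  simp [configReflect, h]

/-- `configReflect` is an involution. [folklore] -/
theorem configReflect_configReflect (μ : Fin d) (A : ZMod S) (U : GaugeConfig d S G) :
    configReflect μ A (configReflect μ A U) = U := by
  funext e
  obtain ⟨x, j⟩ := e
  by_cases h : j = μ
  · subst h
    rw [configReflect_apply_same, configReflect_apply_same, inv_inv, siteReflect_sub_single,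
      siteReflect_siteReflect, add_sub_cancel_right]
  · rw [configReflect_apply_of_ne _ _ _ _ h, configReflect_apply_of_ne _ _ _ _ h, siteReflect_siteReflect]

/-- Consistency: the reflection of the axis `0` through `1/2` is the tree's time reflection. [folklore] -/
theorem configReflect_zero_one [NeZero d] (U : GaugeConfig d S G) :
    configReflect 0 1 U = U.timeReflect := by
  funext e
  simp only [configReflect, GaugeConfig.timeReflect]
  split_ifs <;> rfl

/-- `configReflect` is an involution. [folklore] -/
theorem configReflect_involutive (μ : Fin d) (A : ZMod S) :
    Function.Involutive (configReflect (G := G) μ A) :=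
  configReflect_configReflect μ A

variable [TopologicalSpace G] [IsTopologicalGroup G]

/-- `configReflect` is continuous (product topology). [folklore] -/
theorem continuous_configReflect (μ : Fin d) (A : ZMod S) :
    Continuous (configReflect (G := G) μ A) := by
  refine continuous_pi fun e => ?_
  unfold configReflect
  split_ifs
  · exact (continuous_apply _).inv
  · exact continuous_apply _

variable [MeasurableSpace G] [BorelSpace G]

/-- `configReflect` is measurable. [folklore] -/
theorem measurable_configReflect (μ : Fin d) (A : ZMod S) :
    Measurable (configReflect (G := G) μ A) := by
  refine measurable_pi_lambda _ fun e => ?_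
  unfold configReflect
  split_ifs
  · exact (measurable_pi_apply _).inv
  · exact measurable_pi_apply _

/-- `configReflect` as a measurable equivalence (its own inverse). [folklore] -/
def configReflectEquiv (μ : Fin d) (A : ZMod S) : GaugeConfig d S G ≃ᵐ GaugeConfig d S G where
  toFun := configReflect μ A
  invFun := configReflect μ A
  left_inv := configReflect_configReflect μ A
  right_inv := configReflect_configReflect μ A
  measurable_toFun := measurable_configReflect μ A
  measurable_invFun := measurable_configReflect μ A

/-- The forward map of `configReflectEquiv`. [folklore] -/
@[simp] theorem coe_configReflectEquiv (μ : Fin d) (A : ZMod S) :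
    ⇑(configReflectEquiv (G := G) μ A) = configReflect μ A := rfl

end Config

/-! ## Conjugation to the time reflection -/

section Conj

variable {d S : ℕ} [NeZero d] {G : Type*}

/-- The site bookkeeping of the conjugation: transposing the axes `0, μ`, translating time by `s`, reflecting time
(`t ↦ 1 - t`), translating back and transposing back is the reflection of the axis `μ` through `(1 - 2s)/2`.
[folklore] -/
theorem sitePerm_timeReflect_conj (μ : Fin d) (s : ZMod S) (y : Site d S) :
    sitePerm (Equiv.swap 0 μ) ((sitePerm (Equiv.swap 0 μ) y + Pi.single 0 s).timeReflect - Pi.single 0 s) =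
      siteReflect μ (1 - 2 * s) y := by
  funext k
  rw [sitePerm_apply, Equiv.symm_swap]
  by_cases hk : k = μ
  · subst hk
    rw [Equiv.swap_apply_right, Pi.sub_apply, WilsonRP.timeReflect_apply_zero, Pi.add_apply, sitePerm_apply,
      Equiv.symm_swap, Equiv.swap_apply_left, Pi.single_eq_same, siteReflect_apply_same]
    ring
  · have h0 : Equiv.swap (0 : Fin d) μ k ≠ 0 := by
      rw [Ne, Equiv.swap_apply_eq_iff, Equiv.swap_apply_left]; exact hk
    rw [Pi.sub_apply, WilsonRP.timeReflect_apply_of_ne _ h0, Pi.add_apply, sitePerm_apply, Equiv.symm_swap,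
      Equiv.swap_apply_self, Pi.single_eq_of_ne h0, siteReflect_apply_of_ne _ _ _ hk, sub_zero, add_zero]

variable [MeasurableSpace G]

/-- The conjugating map: transpose the axes `0, μ`, then translate time by `s`. [folklore] -/
def conjFwd (μ : Fin d) (s : ZMod S) : GaugeConfig d S G ≃ᵐ GaugeConfig d S G :=
  (configPerm (Equiv.swap 0 μ)).trans (torusConfigShift (Pi.single 0 s))

/-- `conjFwd` evaluated. [folklore] -/
theorem conjFwd_apply (μ : Fin d) (s : ZMod S) (U : GaugeConfig d S G) :
    conjFwd μ s U = torusConfigShift (Pi.single 0 s) (configPerm (Equiv.swap 0 μ) U) := rfl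

/-- `configPerm` of a transposition is an involution. [folklore] -/
theorem configPerm_swap_configPerm_swap (μ : Fin d) (U : GaugeConfig d S G) :
    configPerm (Equiv.swap 0 μ) (configPerm (Equiv.swap 0 μ) U) = U := by
  funext e
  simp only [configPerm_apply, Equiv.symm_swap, Equiv.swap_apply_self]
  congr 1
  ext1
  · funext k; simp [sitePerm_apply, Equiv.symm_swap, Equiv.swap_apply_self]
  · rfl

/-- The inverse of `conjFwd`: translate time back, then transpose the axes. [folklore] -/
theorem conjFwd_symm_apply (μ : Fin d) (s : ZMod S) (V : GaugeConfig d S G) :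
    (conjFwd μ s).symm V = configPerm (Equiv.swap 0 μ) (torusConfigShift (-Pi.single 0 s) V) := by
  apply (conjFwd (G := G) μ s).injective
  rw [MeasurableEquiv.apply_symm_apply, conjFwd_apply, configPerm_swap_configPerm_swap]
  funext e
  simp [torusConfigShift_apply]

/-- The inverse of `conjFwd` reads the link `(πx + s e₀, πj)`. [folklore] -/
theorem conjFwd_symm_apply_apply (μ : Fin d) (s : ZMod S) (V : GaugeConfig d S G) (e : Edge d S) :
    (conjFwd μ s).symm V e = V (sitePerm (Equiv.swap 0 μ) e.1 + Pi.single 0 s, Equiv.swap 0 μ e.2) := by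
  rw [conjFwd_symm_apply, configPerm_apply, torusConfigShift_apply, Equiv.symm_swap, sub_neg_eq_add]

variable [Group G]

/-- **The wall reflection is a conjugate of the time reflection**:
`configReflect μ (1 - 2s) = conjFwd⁻¹ ∘ Θ ∘ conjFwd`. [folklore] -/
theorem configReflect_eq_conj (μ : Fin d) (s : ZMod S) (U : GaugeConfig d S G) :
    configReflect μ (1 - 2 * s) U = (conjFwd μ s).symm (GaugeConfig.timeReflect (conjFwd μ s U)) := by
  funext e
  obtain ⟨x, j⟩ := e
  rw [conjFwd_symm_apply_apply]
  simp only [GaugeConfig.timeReflect, conjFwd_apply, torusConfigShift_apply, configPerm_apply, Equiv.symm_swap,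
    Equiv.swap_apply_self]
  by_cases hj : j = μ
  · subst hj
    simp only [Equiv.swap_apply_right, ↓reduceIte, configReflect, ← sitePerm_timeReflect_conj j s]
    congr 3
    rw [sitePerm_shift, Equiv.swap_apply_right]
    simp only [Site.shift]
    abel_nf
  · have h0 : Equiv.swap (0 : Fin d) μ j ≠ 0 := by
      rw [Ne, Equiv.swap_apply_eq_iff, Equiv.swap_apply_left]; exact hj
    simp only [h0, ↓reduceIte, configReflect, hj, sitePerm_timeReflect_conj]

/-- Every `A : ℤ/S` is `1 - 2s` on an odd torus (`2 (L + 1) = S + 1 ≡ 1` for `S = 2L + 1`). [folklore] -/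
theorem exists_eq_one_sub_two_mul (hS : Odd S) (A : ZMod S) : ∃ s : ZMod S, A = 1 - 2 * s := by
  obtain ⟨L, rfl⟩ := hS
  refine ⟨((L + 1 : ℕ) : ZMod (2 * L + 1)) * (1 - A), ?_⟩
  have h2 : (2 : ZMod (2 * L + 1)) * ((L + 1 : ℕ) : ZMod (2 * L + 1)) = 1 := by
    have : ((2 * L + 1 : ℕ) : ZMod (2 * L + 1)) = 0 := ZMod.natCast_self _
    push_cast at this ⊢
    linear_combination this
  rw [← mul_assoc, h2]; ring

end Conj

/-! ## Measure preservation -/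

section Measure

variable {d S N : ℕ} [NeZero d] [NeZero S] {G : Type*} [Group G] [TopologicalSpace G] [IsTopologicalGroup G]
  [CompactSpace G] [MeasurableSpace G] [BorelSpace G] (ρ : G →* Matrix (Fin N) (Fin N) ℂ)

/-- The time reflection as a measurable equivalence (its own inverse). [folklore] -/
def timeReflectEquiv : GaugeConfig d S G ≃ᵐ GaugeConfig d S G where
  toFun := GaugeConfig.timeReflect
  invFun := GaugeConfig.timeReflect
  left_inv U := by
    funext e; obtain ⟨x, i⟩ := e
    by_cases hi : i = 0
    · subst hi; simp [GaugeConfig.timeReflect]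
    · simp [GaugeConfig.timeReflect, hi]
  right_inv U := by
    funext e; obtain ⟨x, i⟩ := e
    by_cases hi : i = 0
    · subst hi; simp [GaugeConfig.timeReflect]
    · simp [GaugeConfig.timeReflect, hi]
  measurable_toFun := WilsonRP.measurable_timeReflect
  measurable_invFun := WilsonRP.measurable_timeReflect

omit [NeZero S] [CompactSpace G] in
/-- The forward map of `timeReflectEquiv`. [folklore] -/
@[simp] theorem coe_timeReflectEquiv :
    ⇑(timeReflectEquiv (d := d) (S := S) (G := G)) = GaugeConfig.timeReflect := rfl

omit [MeasurableSpace G] [BorelSpace G] in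
/-- The Wilson action is invariant under the time reflection (the plaquette sum is re-indexed by the involution
`WilsonRP.plaqReflect`, `WilsonRP.plaqRe_timeReflect`). [folklore] -/
theorem wilsonAction_timeReflect (hρ : Continuous ρ) (U : GaugeConfig d S G) :
    wilsonAction ρ U.timeReflect = wilsonAction ρ U := by
  -- adapted from `Summit.QuantumFields.YangMills.Theorems.PoincareToGap.wilsonAction_timeReflect`
  rw [WilsonRP.wilsonAction_eq, WilsonRP.wilsonAction_eq]
  congr 1
  simp_rw [WilsonRP.plaqRe_timeReflect ρ hρ]
  exact Fintype.sum_equiv WilsonRP.plaqReflectEquiv _ _ fun p => rfl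

/-- **Wilson's torus measure is invariant under the time reflection.** [folklore] -/
theorem measurePreserving_timeReflect (hρ : Continuous ρ) (β : ℝ) :
    MeasurePreserving (GaugeConfig.timeReflect : GaugeConfig d S G → GaugeConfig d S G)
      (wilsonMeasure ρ β) (wilsonMeasure ρ β) := by
  -- adapted from `Summit.QuantumFields.YangMills.Theorems.PoincareToGap.stub_wilsonMeasure_timeReflect_invariant`
  refine ⟨WilsonRP.measurable_timeReflect, ?_⟩
  have hπ : (Measure.pi fun _ : Edge d S => haarProbability G).map (⇑(timeReflectEquiv (G := G))) =
      Measure.pi fun _ : Edge d S => haarProbability G :=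
    (WilsonRP.measurePreserving_timeReflect (d := d) (L := S) (G := G)).map_eq
  rw [← coe_timeReflectEquiv]
  simp only [wilsonMeasure, Measure.map_smul, wilsonWeight]
  rw [withDensity_map_of_measurableEquiv _ _ _ hπ]
  intro U
  rw [coe_timeReflectEquiv, wilsonAction_timeReflect ρ hρ]

omit [NeZero d] in
/-- Torus translations preserve Wilson's torus measure. [folklore] -/
theorem measurePreserving_torusConfigShift (β : ℝ) (v : Site d S) :
    MeasurePreserving (⇑(torusConfigShift (G := G) v)) (wilsonMeasure ρ β) (wilsonMeasure ρ β) :=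
  ⟨(torusConfigShift v).measurable, wilsonMeasure_map_torusConfigShift ρ β v⟩

/-- The conjugating map preserves Wilson's torus measure. [folklore] -/
theorem measurePreserving_conjFwd (hρ : Continuous ρ) (β : ℝ) (μ : Fin d) (s : ZMod S) :
    MeasurePreserving (⇑(conjFwd (G := G) μ s)) (wilsonMeasure ρ β) (wilsonMeasure ρ β) :=
  (measurePreserving_torusConfigShift ρ β _).comp (measurePreserving_configPerm_wilsonMeasure ρ hρ β _)

/-- **Wall reflections preserve Wilson's torus measure** (odd torus: every `A` is `1 - 2s`). [folklore] -/
theorem measurePreserving_configReflect (hS : Odd S) (hρ : Continuous ρ) (β : ℝ) (μ : Fin d) (A : ZMod S) :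
    MeasurePreserving (configReflect (G := G) μ A) (wilsonMeasure ρ β) (wilsonMeasure ρ β) := by
  obtain ⟨s, rfl⟩ := exists_eq_one_sub_two_mul hS A
  have h : configReflect (G := G) μ (1 - 2 * s) =
      ⇑(conjFwd (G := G) μ s).symm ∘ GaugeConfig.timeReflect ∘ ⇑(conjFwd (G := G) μ s) :=
    funext fun U => configReflect_eq_conj μ s U
  rw [h]
  exact ((measurePreserving_conjFwd ρ hρ β μ s).symm _).comp
    ((measurePreserving_timeReflect ρ hρ β).comp (measurePreserving_conjFwd ρ hρ β μ s))

/-- Change of variables under a wall reflection. [folklore] -/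
theorem integral_comp_configReflect (hS : Odd S) (hρ : Continuous ρ) (β : ℝ) (μ : Fin d) (A : ZMod S)
    (f : GaugeConfig d S G → ℝ) :
    ∫ U, f (configReflect μ A U) ∂(wilsonMeasure ρ β) = ∫ U, f U ∂(wilsonMeasure ρ β) :=
  (measurePreserving_configReflect ρ hS hρ β μ A).integral_comp
    (configReflectEquiv (G := G) μ A).measurableEmbedding f

end Measure

/-- Anchor of this helper file (registered sub-goal of stmt-QuantumFields-15828, helper of `stub_arrayFunctional`):
on an odd torus every wall reflection `configReflect μ A` preserves Wilson's measure. [folklore] -/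
theorem arrayFunctional_anchor_reflection :
    ∀ {d S N : ℕ} [NeZero d] [NeZero S] {G : Type} [Group G] [TopologicalSpace G] [IsTopologicalGroup G]
      [CompactSpace G] [MeasurableSpace G] [BorelSpace G] (ρ : G →* Matrix (Fin N) (Fin N) ℂ),
      Odd S → Continuous ρ → ∀ (β : ℝ) (μ : Fin d) (A : ZMod S),
        MeasurePreserving (configReflect μ A : GaugeConfig d S G → GaugeConfig d S G)
          (wilsonMeasure ρ β) (wilsonMeasure ρ β) :=
  fun ρ hS hρ β μ A => measurePreserving_configReflect ρ hS hρ β μ A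

end Summit.QuantumFields.YangMills.Theorems.ContinuumLegGivenGap

end
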